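import Mathlib.GroupTheory.Sylow
import Mathlib.GroupTheory.PGroup
import Mathlib.GroupTheory.Perm.Cycle.Type
import Mathlib.Data.Nat.Factorization.Basic
import Mathlib.Topology.Algebra.ClopenNhdofOne
import Mathlib.Topology.Algebra.OpenSubgroup
import Literature.AnabelianGeometry.AbsoluteAnabelian.AbsTopISemiAbsolute
import Literature.AnabelianGeometry.AbsoluteAnabelian.AbsTopII.EllipticAdmissible
import Literature.AnabelianGeometry.AbsoluteAnabelian.AbsTopII.EllipticCuspidalization
import Literature.IUT.HodgeTheaters.PuncturedEllipticCoverings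
import HarnessLib

/-!
# Profinite groups with an `S₃`-quotient — e.g. free profinite groups of rank `≥ 2` — have NO unique roots

Cell `abc-iut` (run/shared/lean/pub/abc-iut/), layer L4 — VACUITY CERTIFICATE for the typing of
"torsion-free" by Mathlib's `IsMulTorsionFree` ("`x ↦ xⁿ` injective for every `n ≠ 0`", i.e. UNIQUE
ROOTS) on profinite geometric fundamental groups (finding T1g11-F1, abc-iut-L5-t1; row «R5-KERNEL /
UNIQUE-ROOTS-FAIL», abc-iut-L4-t12).  [AbsTopI] Lem. 4.1 (iv) and [AbsTopII] Cor. 3.3 (ii) (Mochizuki,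
*Topics in Absolute Anabelian Geometry I, II*, lit keys `paper:url-11ac98ba15fc`, `paper:url-585b8d0ad0d9`)
say "`J ∩ Δ_C` is torsion-free [i.e., the covering determined by `J` is a scheme]" — NO NONTRIVIAL ELEMENT
OF FINITE ORDER.  The tree types this clause in `AbsTopII.semiEllipticDoubleCoverSubgroups` (F-0234),
in the OUTPUT structure `AbsTopII.EllipticCuspidalization` (field `torsionFree_PiD`) and in the
[IUTchI] Cor. 1.2 CERT conjunct `Summit.ABC.IUTFork.Conditional.layer5_held_cor12_v6` (law 7
`htf : IsMulTorsionFree ↥(Π_X ⊓ Δ_C)`) by the STRONGER predicate `IsMulTorsionFree`.  This PROOF-ONLY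
file (no definitions, no named facts) shows that the stronger predicate is UNSATISFIABLE there:
* `exists_comm_sq_of_surjective_S3_finite` — a FINITE group `A` with `α : A ↠ S₃` has `U, X` with
  `[U, X²] = 1`, `α [U, X] ≠ 1` (Sylow `3`-subgroup `P ⊆ α⁻¹(A₃)`; Frattini's argument: a `2`-element
  `X ∈ N_A(P)` over a transposition; conjugation by `X²` on the ODD coset `g (P ∩ Ker α)` has a fixed
  point `U`);
* `exists_comm_sq_ne_of_surjective_S3`, **`not_isMulTorsionFree_of_surjective_S3`** — a PROFINITE group
  with a surjection onto `S₃` (open kernel) has `U, X` with `U X² = X² U`, `U X U⁻¹ ≠ X` (compactness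
  over the open normal subgroups), so `(U X U⁻¹)² = X²` and it is NOT `IsMulTorsionFree`;
* **`not_isMulTorsionFree_of_isFreeProOn`** (`_univ`) — a free pro-`Σ` group of rank `n ≥ 2`,
  `2, 3 ∈ Σ` ([AbsTopI] Lem. 4.5 (i) vocabulary `IsFreeProOn`; e.g. `F̂_n`) is NOT `IsMulTorsionFree`,
  although it IS torsion-free (`IsFreeProOn.torsionFree`).  (Morally: an embedded `ℤ₃ ⋊ ℤ₂`, the
  pro-`{2,3}` Klein-bottle group, `(u x)² = x²`; free pro-`p` groups DO have unique roots.
  -- TODO(general form): the Frobenius group `ℤ/q ⋊ ℤ/p`, `p ∣ q − 1`, in place of `S₃`: every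
  `Σ ⊇ {p, q}`.)
* `not_mem_semiEllipticDoubleCoverSubgroups_of_surjective_S3` / `_of_isFreeProOn`,
  `ellipticCuspidalization_not_surjective_S3` — a `J ⊆ Π_C` whose `J ∩ Δ_C` has an `S₃`-quotient (e.g.
  the `π₁` of a once-punctured elliptic curve, `2, 3 ∈ Σ`) is NOT in the typed RHS of Cor. 3.3 (ii);
  the typed OUTPUT of Cor. 3.3 bars `S₃`-quotients of `Π_D ∩ Δ_C`;
* **`cor12_htf_false_of_isFreeProOn`** — at `D : PuncturedEllipticData` ([IUTchI] §1) the origin datum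
  "(A) `Δ_X = Π_X ∩ Δ_C` free profinite on `≥ 2` generators" REFUTES law 7 of `layer5_held_cor12_v6`:
  the binder set {(A), law 7} is EMPTY.
READING (numbers, not adjectives): at `Σ ⊇ {2, 3}` — in particular for the full profinite `Δ_X ≅ F̂₂` of
[IUTchI] §1 — every binder or field `IsMulTorsionFree ↥(… ⊓ Δ_C)` is FALSE at the intended datum; a
closer displaying (A) next to such a binder is VACUOUS; the print-faithful reading
`∀ g, IsOfFinOrder g → g = 1` is a THEOREM under (A).  For pro-`Σ` with `2 ∉ Σ` or `3 ∉ Σ` this file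
says nothing.  HONEST FRAMING: classical (pro)finite group theory, elementary (no projectivity /
`cd ≤ 1`); refuted-as-TYPED at OUR predicate, not a statement about print; nothing here bears on
[IUTchIII] Cor. 3.12; typed ≠ proved elsewhere.
-/

noncomputable section

open Topology Equiv Equiv.Perm

namespace Summit.ABC.IUTFork

open Literature.AnabelianGeometry.AbsoluteAnabelian

universe u

/-- An odd element of `S₃` is a transposition: its square is `1`. [folklore] -/
private theorem sq_eq_one_of_sign : ∀ κ : Perm (Fin 3), sign κ = -1 → κ * κ = 1 := by decide

/-- A nontrivial even element of `S₃` and an odd one do not commute. [folklore] -/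
private theorem comm_ne_one :
    ∀ ρ κ : Perm (Fin 3), sign ρ = 1 → ρ ≠ 1 → sign κ = -1 → ρ * κ * ρ⁻¹ * κ⁻¹ ≠ 1 := by decide

/-- Every element of `S₃` is a word `σⁱ τʲ`, `σ = (0 1 2)`, `τ = (0 1)`, `i < 3`, `j < 2`. [folklore] -/
private theorem eq_words : ∀ x : Perm (Fin 3), x = 1 ∨ x = swap 0 1 * swap 1 2 ∨
    x = swap 0 1 * swap 1 2 * (swap 0 1 * swap 1 2) ∨ x = swap 0 1 ∨
    x = swap 0 1 * swap 1 2 * swap 0 1 ∨ x = swap 0 1 * swap 1 2 * (swap 0 1 * swap 1 2) * swap 0 1 := by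
  decide

/-- An element of `S₃` of `3`-power order is even. [folklore] -/
private theorem sign_eq_one_of_pow_three_pow {x : Perm (Fin 3)} {k : ℕ} (hx : x ^ 3 ^ k = 1) : sign x = 1 := by
  rcases Int.units_eq_one_or (sign x) with h | h
  · exact h
  · have h' := map_pow sign x (3 ^ k)
    rw [hx, map_one, h, Odd.neg_one_pow (Odd.pow (by decide))] at h'
    exact absurd h' (by decide)

/-- `σ ^ m ≠ 1` for the `3`-cycle `σ = (0 1 2)` when `3 ∤ m`. [folklore] -/
private theorem sigma_pow_ne_one {m : ℕ} (hm : ¬ 3 ∣ m) : (swap 0 1 * swap 1 2 : Perm (Fin 3)) ^ m ≠ 1 := by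
  rw [← Nat.div_add_mod m 3, pow_add, pow_mul, (by decide : (swap 0 1 * swap 1 2 : Perm (Fin 3)) ^ 3 = 1),
    one_pow, one_mul]
  have h : m % 3 = 1 ∨ m % 3 = 2 := by omega
  rcases h with h | h <;> rw [h] <;> decide

/-- **Finite level.**  In a finite group `A` with a surjection `α : A ↠ S₃` there are `U, X ∈ A` with
`U X² = X² U` and `α(U X U⁻¹ X⁻¹) ≠ 1` (a `3`-element `g` over a `3`-cycle lies in a Sylow `3`-subgroup
`P ⊆ α⁻¹(A₃)`; Frattini: `X ∈ N_A(P)` over a transposition, wlog a `2`-element; `X²` (over `1`) permutes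
the coset `g (P ∩ Ker α)` of odd size and has a fixed point `U`). [folklore] -/
theorem exists_comm_sq_of_surjective_S3_finite {A : Type*} [Group A] [Finite A]
    (α : A →* Perm (Fin 3)) (hα : Function.Surjective α) :
    ∃ U X : A, U * X ^ 2 = X ^ 2 * U ∧ α (U * X * U⁻¹ * X⁻¹) ≠ 1 := by
  classical
  haveI : Fact (Nat.Prime 3) := ⟨Nat.prime_three⟩
  haveI : Fact (Nat.Prime 2) := ⟨Nat.prime_two⟩
  let N₃ : Subgroup A := (sign.comp α).ker
  obtain ⟨a, ha⟩ := hα (swap 0 1 * swap 1 2)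
  obtain ⟨e, m, hm3, hord⟩ := Nat.exists_eq_pow_mul_and_not_dvd (orderOf_pos a).ne' 3 (by decide)
  set g : A := a ^ m with hg_def
  have hg3 : g ^ 3 ^ e = 1 := by rw [hg_def, ← pow_mul, mul_comm, ← hord]; exact pow_orderOf_eq_one a
  have hαg : α g = (swap 0 1 * swap 1 2) ^ m := by rw [hg_def, map_pow, ha]
  have hαg_sign : sign (α g) = 1 := by rw [hαg, map_pow, map_mul, sign_swap, sign_swap] <;> simp
  have hαg_ne : α g ≠ 1 := hαg ▸ sigma_pow_ne_one hm3
  have hzp : IsPGroup 3 (Subgroup.zpowers g) := by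
    rintro ⟨x, hx⟩
    obtain ⟨i, rfl⟩ := Subgroup.mem_zpowers_iff.mp hx
    refine ⟨e, Subtype.ext ?_⟩
    simp only [SubmonoidClass.mk_pow, OneMemClass.coe_one]
    rw [← zpow_natCast, ← zpow_mul, mul_comm, zpow_mul, zpow_natCast, hg3, one_zpow]
  obtain ⟨P, hgP⟩ := hzp.exists_le_sylow
  have hgP : g ∈ (P : Subgroup A) := hgP (Subgroup.mem_zpowers g)
  have hPN : (P : Subgroup A) ≤ N₃ := by
    intro x hx
    obtain ⟨k, hk⟩ := P.isPGroup' ⟨x, hx⟩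
    have hxk : x ^ 3 ^ k = 1 := by simpa using congrArg Subtype.val hk
    show sign (α x) = 1
    exact sign_eq_one_of_pow_three_pow (by rw [← map_pow, hxk, map_one])
  have hfrat := Sylow.normalizer_sup_eq_top' P hPN
  obtain ⟨b, hb⟩ := hα (swap 0 1)
  have hbN : b ∉ N₃ := show sign (α b) ≠ 1 by rw [hb, sign_swap (by decide)]; decide
  have hnot : ¬ Subgroup.normalizer ((P : Subgroup A) : Set A) ≤ N₃ := by
    intro hle
    have htop : N₃ = ⊤ := by rw [← hfrat]; exact (sup_eq_right.mpr hle).symm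
    exact hbN (htop ▸ Subgroup.mem_top b)
  obtain ⟨X', hX'norm, hX'N⟩ := SetLike.not_le_iff_exists.mp hnot
  have hκ' : sign (α X') = -1 :=
    (Int.units_eq_one_or _).resolve_left (fun h => hX'N (show sign (α X') = 1 from h))
  obtain ⟨e₂, m₂, hm₂, hord₂⟩ := Nat.exists_eq_two_pow_mul_odd (orderOf_pos X').ne'
  set X : A := X' ^ m₂ with hX_def
  have hXnorm := Subgroup.pow_mem _ hX'norm m₂
  have hX2 : X ^ 2 ^ e₂ = 1 := by rw [hX_def, ← pow_mul, mul_comm, ← hord₂]; exact pow_orderOf_eq_one X'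
  have hκsq : α X' * α X' = 1 := sq_eq_one_of_sign _ hκ'
  have hαX : α X = α X' := by
    obtain ⟨j, hj⟩ := hm₂
    rw [hX_def, map_pow, hj, pow_succ, pow_mul, pow_two, hκsq, one_pow, one_mul]
  set y : A := X ^ 2 with hy_def
  have hαy : α y = 1 := by rw [hy_def, map_pow, hαX, pow_two, hκsq]
  have hynorm : y ∈ Subgroup.normalizer ((P : Subgroup A) : Set A) := Subgroup.pow_mem _ hXnorm 2
  have hy2 : y ^ 2 ^ e₂ = 1 := by rw [hy_def, ← pow_mul, mul_comm, pow_mul, hX2, one_pow]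
  have hyn := Subgroup.mem_normalizer_iff.mp hynorm
  have hyn' := Subgroup.mem_normalizer_iff''.mp hynorm
  -- the coset `S := g (P ∩ Ker α) = {h ∈ P | α h = α g}` has odd size
  let S : Set A := {h | h ∈ (P : Subgroup A) ∧ α h = α g}
  haveI : Fintype S := Fintype.ofFinite S
  let eS : S ≃ ↥((P : Subgroup A) ⊓ α.ker) :=
    { toFun := fun h => ⟨g⁻¹ * h, Subgroup.mem_inf.mpr
        ⟨(P : Subgroup A).mul_mem ((P : Subgroup A).inv_mem hgP) h.2.1,
          by rw [MonoidHom.mem_ker, map_mul, map_inv, h.2.2, inv_mul_cancel]⟩⟩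
      invFun := fun k => ⟨g * k, ⟨(P : Subgroup A).mul_mem hgP (Subgroup.mem_inf.mp k.2).1,
          by rw [map_mul, (MonoidHom.mem_ker).mp (Subgroup.mem_inf.mp k.2).2, mul_one]⟩⟩
      left_inv := fun h => by ext; simp
      right_inv := fun k => by ext; simp }
  have hcardS : Odd (Fintype.card S) := by
    rw [← Nat.card_eq_fintype_card, Nat.card_congr eS]
    obtain ⟨j, hj⟩ := IsPGroup.iff_card.mp (P.isPGroup'.to_le inf_le_left :
      IsPGroup 3 ↥((P : Subgroup A) ⊓ α.ker))
    exact hj ▸ Odd.pow (by decide)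
  -- conjugation by `y` permutes `S`; as a `2`-power root of the identity it has a fixed point
  have hmemS : ∀ h : A, h ∈ S → y * h * y⁻¹ ∈ S := fun h hh =>
    ⟨(hyn h).mp hh.1, by rw [map_mul, map_mul, map_inv, hαy, hh.2, one_mul, inv_one, mul_one]⟩
  have hmemS' : ∀ h : A, h ∈ S → y⁻¹ * h * y ∈ S := fun h hh =>
    ⟨(hyn' h).mp hh.1, by rw [map_mul, map_mul, map_inv, hαy, hh.2, inv_one, one_mul, mul_one]⟩
  let τS : Perm S :=
    { toFun := fun h => ⟨y * h * y⁻¹, hmemS h.1 h.2⟩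
      invFun := fun h => ⟨y⁻¹ * h * y, hmemS' h.1 h.2⟩
      left_inv := fun h => by ext; simp [mul_assoc]
      right_inv := fun h => by ext; simp [mul_assoc] }
  have hτS_iter : ∀ (k : ℕ) (h : S), ((τS ^ k) h : A) = y ^ k * h * (y ^ k)⁻¹ := by
    intro k
    induction k with
    | zero => intro h; simp
    | succ k ih =>
      intro h
      rw [pow_succ', Perm.mul_apply]
      show y * ((τS ^ k) h : A) * y⁻¹ = _
      rw [ih, pow_succ', mul_inv_rev]
      simp only [mul_assoc]
  have hτS : τS ^ 2 ^ e₂ = 1 := by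
    ext h
    rw [hτS_iter, hy2, Perm.coe_one, id_eq, one_mul, inv_one, mul_one]
  obtain ⟨U, hU⟩ := Equiv.Perm.exists_fixed_point_of_prime (p := 2) (n := e₂)
    hcardS.not_two_dvd_nat hτS
  have hyU : y * U * y⁻¹ = U := congrArg Subtype.val hU
  refine ⟨U, X, hy_def ▸ (mul_inv_eq_iff_eq_mul.mp hyU).symm, ?_⟩
  · rw [map_mul, map_mul, map_mul, map_inv, map_inv, U.2.2, hαX]
    exact comm_ne_one _ _ hαg_sign hαg_ne hκ'

/-- **Profinite level.**  In a compact Hausdorff totally disconnected topological group `G` with a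
surjection `φ : G ↠ S₃` whose kernel is open there are `U, X` with `U X² = X² U` and `U X U⁻¹ ≠ X`
(for `N ⊴ G` open normal the closed set `C_N = {(U, X) : U X² U⁻¹ X⁻² ∈ N, U X U⁻¹ X⁻¹ ∉ Ker φ}` is
nonempty — the finite level in `G / (N ∩ Ker φ)` — and `N ↦ C_N` is directed: `⋂_N C_N ≠ ∅` by
compactness, and `⋂_N N = 1`). [folklore] -/
theorem exists_comm_sq_ne_of_surjective_S3 {G : Type*} [Group G] [TopologicalSpace G]
    [IsTopologicalGroup G] [CompactSpace G] [T2Space G] [TotallyDisconnectedSpace G]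
    (φ : G →* Perm (Fin 3)) (hker : IsOpen (φ.ker : Set G)) (hφ : Function.Surjective φ) :
    ∃ U X : G, U * X ^ 2 = X ^ 2 * U ∧ U * X * U⁻¹ ≠ X := by
  classical
  let c₁ : G × G → G := fun z => z.1 * z.2 ^ 2 * z.1⁻¹ * (z.2 ^ 2)⁻¹
  let c₂ : G × G → G := fun z => z.1 * z.2 * z.1⁻¹ * z.2⁻¹
  have hc₁ : Continuous c₁ := by fun_prop
  have hc₂ : Continuous c₂ := by fun_prop
  let K : OpenNormalSubgroup G := ⟨⟨φ.ker, hker⟩, inferInstance⟩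
  let C : OpenNormalSubgroup G → Set (G × G) := fun N =>
    c₁ ⁻¹' (N : Set G) ∩ (c₂ ⁻¹' (φ.ker : Set G))ᶜ
  have hCclosed : ∀ N, IsClosed (C N) := fun N =>
    (N.toOpenSubgroup.isClosed.preimage hc₁).inter (hker.preimage hc₂).isClosed_compl
  have hCne : ∀ N, (C N).Nonempty := by
    intro N
    let M : OpenNormalSubgroup G := N ⊓ K
    have hMK : (M : Subgroup G) ≤ φ.ker := fun x hx => (inf_le_right : N ⊓ K ≤ K) hx
    have hMN : (M : Subgroup G) ≤ (N : Subgroup G) := fun x hx => (inf_le_left : N ⊓ K ≤ N) hx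
    haveI : Finite (G ⧸ (M : Subgroup G)) :=
      inferInstanceAs (Finite (G ⧸ M.toOpenSubgroup.toSubgroup))
    let αq : G ⧸ (M : Subgroup G) →* Perm (Fin 3) := QuotientGroup.lift _ φ hMK
    have hαq : Function.Surjective αq := fun s => by
      obtain ⟨x, rfl⟩ := hφ s
      exact ⟨QuotientGroup.mk x, by simp [αq]⟩
    obtain ⟨Ub, Xb, hcomm, hne⟩ := exists_comm_sq_of_surjective_S3_finite αq hαq
    obtain ⟨U, rfl⟩ := QuotientGroup.mk_surjective Ub
    obtain ⟨X, rfl⟩ := QuotientGroup.mk_surjective Xb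
    refine ⟨(U, X), ?_, ?_⟩
    · show c₁ (U, X) ∈ (N : Set G)
      apply hMN
      rw [← QuotientGroup.eq_one_iff]
      simp only [c₁, QuotientGroup.mk_mul, QuotientGroup.mk_inv, QuotientGroup.mk_pow]
      rw [hcomm, mul_inv_cancel_right, mul_inv_cancel]
    · show (U, X) ∉ c₂ ⁻¹' (φ.ker : Set G)
      intro h
      apply hne
      have h' : φ (U * X * U⁻¹ * X⁻¹) = 1 := h
      simpa [αq] using h'
  have hCdir : Directed (· ⊇ ·) C := fun N₁ N₂ =>
    ⟨N₁ ⊓ N₂, fun z hz => ⟨(inf_le_left : N₁ ⊓ N₂ ≤ N₁) hz.1, hz.2⟩,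
      fun z hz => ⟨(inf_le_right : N₁ ⊓ N₂ ≤ N₂) hz.1, hz.2⟩⟩
  haveI : Nonempty (OpenNormalSubgroup G) := ⟨K⟩
  obtain ⟨⟨U, X⟩, hz⟩ := IsCompact.nonempty_iInter_of_directed_nonempty_isCompact_isClosed C hCdir
    hCne (fun N => (hCclosed N).isCompact) hCclosed
  have hz' : ∀ N, (U, X) ∈ C N := fun N => Set.mem_iInter.mp hz N
  refine ⟨U, X, ?_, fun h => ?_⟩
  · have h1 : c₁ (U, X) = 1 := by
      by_contra hw
      obtain ⟨N, hN⟩ := ProfiniteGrp.exist_openNormalSubgroup_sub_open_nhds_of_one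
        (isOpen_compl_singleton (x := c₁ (U, X))) (by simpa using (Ne.symm hw))
      exact hN (hz' N).1 rfl
    have h1' : U * X ^ 2 * U⁻¹ * (X ^ 2)⁻¹ = 1 := h1
    rw [mul_inv_eq_one, mul_inv_eq_iff_eq_mul] at h1'
    exact h1'
  · apply (hz' K).2
    show φ (U * X * U⁻¹ * X⁻¹) = 1
    rw [h, mul_inv_cancel, map_one]

/-- **A profinite group with an `S₃`-quotient does not have unique roots**: a compact Hausdorff totally
disconnected topological group with a surjection onto `S₃` with open kernel is NOT `IsMulTorsionFree`
(`(U X U⁻¹)² = U X² U⁻¹ = X²` but `U X U⁻¹ ≠ X`). [folklore] -/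
theorem not_isMulTorsionFree_of_surjective_S3 {G : Type*} [Group G] [TopologicalSpace G]
    [IsTopologicalGroup G] [CompactSpace G] [T2Space G] [TotallyDisconnectedSpace G]
    (φ : G →* Perm (Fin 3)) (hker : IsOpen (φ.ker : Set G)) (hφ : Function.Surjective φ) :
    ¬ IsMulTorsionFree G := by
  intro htf
  obtain ⟨U, X, hcomm, hne⟩ := exists_comm_sq_ne_of_surjective_S3 φ hker hφ
  have hsq : (U * X * U⁻¹) ^ 2 = X ^ 2 := by rw [conj_pow, hcomm, mul_inv_cancel_right]
  exact hne (IsMulTorsionFree.pow_left_injective two_ne_zero hsq)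

section FreePro

variable {G : Type u} [Group G] [TopologicalSpace G]
variable {S : Set ℕ} {n : ℕ} {gens : Fin n → G}

/-- **A free pro-`Σ` group of rank `≥ 2` with `2, 3 ∈ Σ` surjects continuously onto `S₃`** (generators
`0 ↦ (0 1 2)`, `1 ↦ (0 1)`, the others `↦ 1`; the universal property of `IsFreeProOn`, [AbsTopI] Lem. 4.5
(i), applies as `S₃` is a finite `{2, 3}`-group). [cite: MochizukiAbsTopI2012, Lemma 4.5 (i) p.54] -/
theorem exists_surjective_S3_of_isFreeProOn (h : IsFreeProOn G S gens) (hn : 2 ≤ n) (h2 : 2 ∈ S)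
    (h3 : 3 ∈ S) : ∃ φ : G →* Perm (Fin 3), IsOpen (φ.ker : Set G) ∧ Function.Surjective φ := by
  classical
  letI : TopologicalSpace (Perm (Fin 3)) := ⊥
  haveI : DiscreteTopology (Perm (Fin 3)) := ⟨rfl⟩
  have hK : ∀ q : ℕ, q.Prime → q ∣ Nat.card (Perm (Fin 3)) → q ∈ S := by
    intro q hq hdvd
    rw [Nat.card_eq_fintype_card, Fintype.card_perm, Fintype.card_fin] at hdvd
    have h6 : q ∣ 2 * 3 := by simpa [Nat.factorial] using hdvd
    rcases (Nat.Prime.dvd_mul hq).mp h6 with h | h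
    · rwa [(Nat.prime_dvd_prime_iff_eq hq Nat.prime_two).mp h]
    · rwa [(Nat.prime_dvd_prime_iff_eq hq Nat.prime_three).mp h]
  let f : Fin n → Perm (Fin 3) := fun i =>
    if (i : ℕ) = 0 then swap 0 1 * swap 1 2 else if (i : ℕ) = 1 then swap 0 1 else 1
  obtain ⟨φ, ⟨hφc, hφf⟩, -⟩ := h.2 (Perm (Fin 3)) hK f
  have h0 : φ (gens ⟨0, by omega⟩) = swap 0 1 * swap 1 2 := by rw [hφf]; simp [f]
  have h1 : φ (gens ⟨1, by omega⟩) = swap 0 1 := by rw [hφf]; simp [f]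
  refine ⟨φ, ?_, fun s => ?_⟩
  · have : (φ.ker : Set G) = φ ⁻¹' {1} := by ext x; simp
    rw [this]
    exact (isOpen_discrete _).preimage hφc
  · rcases eq_words s with rfl | rfl | rfl | rfl | rfl | rfl
    · exact ⟨1, map_one φ⟩
    · exact ⟨_, h0⟩
    · exact ⟨gens ⟨0, by omega⟩ * gens ⟨0, by omega⟩, by rw [map_mul, h0]⟩
    · exact ⟨_, h1⟩
    · exact ⟨gens ⟨0, by omega⟩ * gens ⟨1, by omega⟩, by rw [map_mul, h0, h1]⟩
    · exact ⟨gens ⟨0, by omega⟩ * gens ⟨0, by omega⟩ * gens ⟨1, by omega⟩,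
        by rw [map_mul, map_mul, h0, h1]⟩

variable [IsTopologicalGroup G] [CompactSpace G] [T2Space G] [TotallyDisconnectedSpace G]

/-- **Free pro-`Σ` groups of rank `≥ 2` with `2, 3 ∈ Σ` — in particular free profinite groups `F̂_n`,
`n ≥ 2` — do NOT have unique roots**: `IsFreeProOn G Σ gens`, `2 ≤ n`, `2, 3 ∈ Σ` ⇒
`¬ IsMulTorsionFree G` (although `G` IS torsion-free: `IsFreeProOn.torsionFree`); Mathlib's
`IsMulTorsionFree` ("`x ↦ xⁿ` injective") is thus NOT a typing of "torsion-free" for such groups.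
[cite: MochizukiAbsTopI2012, Lemma 4.5 (i) p.54] -/
theorem not_isMulTorsionFree_of_isFreeProOn (h : IsFreeProOn G S gens) (hn : 2 ≤ n) (h2 : 2 ∈ S)
    (h3 : 3 ∈ S) : ¬ IsMulTorsionFree G := by
  obtain ⟨φ, hker, hφ⟩ := exists_surjective_S3_of_isFreeProOn h hn h2 h3
  exact not_isMulTorsionFree_of_surjective_S3 φ hker hφ

/-- The free PROFINITE case (`Σ` = all primes — the shape `IsFreeProOn ↥Δ_X Set.univ gens` of the
[IUTchI] Cor. 1.2 origin datum "(A) `Δ_X` free profinite on two generators"): NOT `IsMulTorsionFree`.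
[cite: MochizukiAbsTopI2012, Lemma 4.5 (i) p.54] -/
theorem not_isMulTorsionFree_of_isFreeProOn_univ (h : IsFreeProOn G Set.univ gens) (hn : 2 ≤ n) :
    ¬ IsMulTorsionFree G :=
  not_isMulTorsionFree_of_isFreeProOn h hn (Set.mem_univ 2) (Set.mem_univ 3)

end FreePro

section Cor33

open AbsTopII

variable (C : FundamentalExtension.{u})

/-- For an open `J ⊆ Π`, the subgroup `J ∩ Δ` of the profinite `Π` is closed, hence compact.
[cite: MochizukiAbsTopIII2015, Thm 1.9 p.37] -/
theorem compactSpace_inf_geom (J : Subgroup C.arith) (hJ : IsOpen (J : Set C.arith)) :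
    CompactSpace ↥(J ⊓ C.geom) := by
  have hcl : IsClosed ((J ⊓ C.geom : Subgroup C.arith) : Set C.arith) := by
    rw [Subgroup.coe_inf]
    exact (Subgroup.isClosed_of_isOpen J hJ).inter C.isClosed_geom
  exact isCompact_iff_compactSpace.mp hcl.isCompact

/-- **An open `J ⊆ Π_C` whose `J ∩ Δ_C` has an `S₃`-quotient is NOT in the typed right-hand side of
[AbsTopII] Cor. 3.3 (ii)** (`semiEllipticDoubleCoverSubgroups`, F-0234, which types "`J ∩ Δ_C` is
torsion-free [i.e., the covering determined by `J` is a scheme]" as `IsMulTorsionFree`).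
[cite: MochizukiAbsTopII2013, Cor 3.3 (ii) p.68] -/
theorem not_mem_semiEllipticDoubleCoverSubgroups_of_surjective_S3 (J : Subgroup C.arith)
    (φ : ↥(J ⊓ C.geom) →* Perm (Fin 3)) (hker : IsOpen (φ.ker : Set ↥(J ⊓ C.geom)))
    (hφ : Function.Surjective φ) : J ∉ semiEllipticDoubleCoverSubgroups C := by
  rintro ⟨hopen, -, htf⟩
  haveI := compactSpace_inf_geom C J hopen
  exact not_isMulTorsionFree_of_surjective_S3 φ hker hφ htf

/-- **If `J ∩ Δ_C` is free pro-`Σ` of rank `≥ 2` with `2, 3 ∈ Σ`** — e.g. the pro-`Σ` geometric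
fundamental group of a once-punctured elliptic curve ([AbsTopI] Lem. 4.5 (i)) — **then
`J ∉ semiEllipticDoubleCoverSubgroups Π_C`**, although print's double coverings `D → C` "that exhibit
`C` as semi-elliptic" are exactly of this kind: at `Σ ⊇ {2, 3}` the typed RHS of Cor. 3.3 (ii) EXCLUDES
the printed LHS. [cite: MochizukiAbsTopII2013, Cor 3.3 (ii) p.68] -/
theorem not_mem_semiEllipticDoubleCoverSubgroups_of_isFreeProOn (J : Subgroup C.arith)
    {S : Set ℕ} {n : ℕ} {gens : Fin n → ↥(J ⊓ C.geom)} (hfree : IsFreeProOn ↥(J ⊓ C.geom) S gens)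
    (hn : 2 ≤ n) (h2 : 2 ∈ S) (h3 : 3 ∈ S) : J ∉ semiEllipticDoubleCoverSubgroups C := by
  obtain ⟨φ, hker, hφ⟩ := exists_surjective_S3_of_isFreeProOn hfree hn h2 h3
  exact not_mem_semiEllipticDoubleCoverSubgroups_of_surjective_S3 C J φ hker hφ

variable {E : FundamentalExtension.{u}} (X : EllipticCuspidalization E)

/-- **The typed OUTPUT structure of [AbsTopII] Cor. 3.3 forces `Π_D ∩ Δ_C` to have NO `S₃`-quotient**
(field `torsionFree_PiD : IsMulTorsionFree ↥(Π_D ⊓ Δ_C)`), whereas print's `D`, the double covering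
"that exhibits `C` as semi-elliptic" — a once-punctured elliptic curve — has pro-`Σ` geometric
fundamental group free pro-`Σ` of rank `2`, which surjects onto `S₃` when `2, 3 ∈ Σ`.
[cite: MochizukiAbsTopII2013, Cor 3.3 (ii) p.68] -/
theorem ellipticCuspidalization_not_surjective_S3 (φ : ↥(X.PiD ⊓ X.core.geom) →* Perm (Fin 3))
    (hker : IsOpen (φ.ker : Set ↥(X.PiD ⊓ X.core.geom))) : ¬ Function.Surjective φ := by
  intro hφ
  haveI := compactSpace_inf_geom X.core X.PiD X.isOpen_PiD
  exact not_isMulTorsionFree_of_surjective_S3 φ hker hφ X.torsionFree_PiD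

end Cor33

open Literature.IUT.HodgeTheaters in
/-- **At `D : PuncturedEllipticData` ([IUTchI] §1) the classical origin datum "(A) `Δ_X := Π_X ∩ Δ_C`
is free profinite on `n ≥ 2` generators" REFUTES law 7 `htf : IsMulTorsionFree ↥(Π_X ⊓ Δ_C)` of the
CERT conjunct `layer5_held_cor12_v6` (`Conditional/Layer5OfSV10.lean`)** — the binder set {(A), law 7}
is EMPTY, so a closer carrying both is vacuous; the print-faithful law 7 is
`∀ g : ↥(Π_X ⊓ Δ_C), IsOfFinOrder g → g = 1` (`IsFreeProOn.torsionFree`, a theorem under (A)).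
[cite: MochizukiAbsTopII2013, Cor 3.3 (ii) p.68] -/
theorem cor12_htf_false_of_isFreeProOn (D : PuncturedEllipticData.{u}) {n : ℕ} {gens : Fin n → ↥(D.PiX ⊓ D.DeltaC)}
    (hfree : IsFreeProOn ↥(D.PiX ⊓ D.DeltaC) Set.univ gens) (hn : 2 ≤ n) :
    ¬ IsMulTorsionFree ↥(D.PiX ⊓ D.DeltaC) := by
  haveI : CompactSpace ↥(D.PiX ⊓ D.DeltaC) := compactSpace_inf_geom D.E D.PiX D.isOpen_piX
  exact not_isMulTorsionFree_of_isFreeProOn_univ hfree hn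

end Summit.ABC.IUTFork

end
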